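import Literature.MathematicalPhysics.QuantumFieldTheory.Balaban1983to89.B8Thm4CoreZdGF3HP2PerLanEGamma
import Literature.MathematicalPhysics.QuantumFieldTheory.Balaban1983to89.B8Thm8SurvivingZd3H

/-!
# `Balaban1983to89.B8Thm8SurvivingZdGF3HP2PerMapLanEGammaGuarded` — [Balaban1985RegularSpaces] THEOREM 8 (p. 101), SURVIVING FORM, ON THE PERIODIC
# SUB-MODEL `zdGF3HP₂Per ∘ (ι, p)` OF THE EDITION-δ₂ P-CARRIER, WITH PERIODICITY-GUARDED SOCKETS AND NO «EXACTLY ONE ⇒ PERIODIC» DEVICE — brick T6c of the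
# package «N05-(β′)-GT» (director-ym №227 (b) «GUARDED REQUIRED»; plan g87 (R6)): dag-n05-d's ℤᵈ server `B8Thm8SurvivingZdGF3HP2MapLanEGamma` (D7-3(C)₂) RE-RUN TOKEN FOR TOKEN on this seat's periodic Theorem-4 core `B8Thm4CoreZdGF3HP2PerLanEGamma.thm4Core_zdGF3HP₂Per_map_lanE_γ'` (T5, p653438)

statement-level skeleton of published theorems with citation tags; proofs where landed; nothing here is a claim about the Yang–Mills mass gap

T. Bałaban, *Spaces of regular gauge field configurations on a lattice and gauge fixing conditions*, Commun. Math. Phys. **99** (1985) 75–102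
`[Balaban1985RegularSpaces]` ("B8"): Thm 8 (1.146) p. 101, Thm 4 p. 88, Thm 2 p. 83, Prop. 3 p. 87 ((1.61), (1.65)–(1.66)), Prop. 5 p. 94, (1.29) p. 81, (1.31) p. 82,
(1.35) p. 82, (1.36)–(1.38) p. 82 («on Ω_j»), (1.42) p. 83, (1.62) p. 87, p. 77 («Ω_j ⊂ T_η»); [4] = [Balaban1985BackgroundPropagators] Thm 3.3 p. 398, (3.40) p. 397.
PDF held: `paper:balaban1985-cmp99-regular-spaces-gauge-fixing` (journal page = PDF page + 74).

CITATION HEADER (lean-in-tree rule).  Cell `pub-ymgap` (HUMAN RULING D-0062, Track A), DAG node N05 = [B8], seat `pub-ymgap-dag-n05-c` (g17; package row (R6) T6c).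
WHY THIS FILE.  On the discharge road of record (director-ym №227 (b)) Theorem 8's surviving form at the κ-periodic members must be obtained from sockets asked at
PERIODIC data only.  dag-n05-d's (7) `B8Thm8SurvivingZdGF3HP2PerMapLanEGamma` (p645630) obtains it from the ℤᵈ server + the ℤᵈ core by the «exactly one ⇒ periodic»
device (E8a) — its sockets are the UNGUARDED ℤᵈ ones, hence BANKED.  THIS FILE re-runs the ℤᵈ server's ASSEMBLY ITSELF (not the device) at the periodic member
`zdGF3HP₂Per 𝔸 L β len (ι a) (p a)`: the Theorem-4-shaped core is T5 (periodic witness BY CONSTRUCTION), the four Theorem-4 sockets are dag-n05-w1's GUARDED texts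
(T4b) with the source admissibility `Adm a f U₀ α₀ α₁ := ((InR138 ∧ Hermitian ∧ support ∧ Bdd) ∧ IsPeriodic (p a) f) ∧ ‖f‖ < γ(α₀ + α₁)` — so EVERY socket
is asked at a periodic pair, a PERIODIC SOURCE and periodic intermediate objects — and the sourced Proposition 3 `SP3src` is stated AT THE PERIODIC MEMBER
(`U₀ : Cfg`, `P′ : Pert`, `f : Src` of `zdGF3HP₂Per`, i.e. periodic).  Everything else (threshold, shifted pair `α″ = 11d²(α₀+α₁) + α₁`, windows, (1.65) ⇒ (1.66)₀,
(1.37) at the original `α₁` by dag-n05-w2's `H42_of_inAx_γ'`, constants) is the ℤᵈ server's text.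

WHAT THIS FILE PROVES (one theorem, no `def`).
★★★ `thm8SurvivingAt_zdGF3HP₂Per_map_lanE_γ'_guarded` — `B8Thm8Surviving.Thm8SurvivingAt γ (5dL·B₈·(1+11d²)) (5dL·B₀β·(1+11d²)) (fun a => zdGF3HP₂Per 𝔸 L β len (ι a) (p a))`
for any `ι : J → ZdIdx d L`, `p : J → ℕ` into `Ω 0 = univ` members with the tower law at every truncation and `(p a)`-periodic `Ω_j` (`j ≤ k`), MODULO the
GUARDED `SP5base ∕ SP5 ∕ SH59src ∕ SP5u` (periodic source admissibility) and the periodic-member `SP3src`, AT `ι a`.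

HONEST SCOPE.  Re-keying ∕ assembly BY NAME: Proposition 5 (both halves, sourced), the sourced b9 socket and the sourced Proposition 3 remain HYPOTHESES (at `ι a`,
now askable at periodic data only — servable in shape by torus statements; the SUPPLIER side is open); no estimate is proved here beyond the cited assembly;
constants unchanged; `≤` where print has `<`; `T_η` as `(p a)`-periodic data on `ηℤᵈ`.  Count-neutral; N05 NOT discharged; one finite `T⁴` programme at fixed
`ε`; nothing continuum ∕ ℝ⁴ ∕ OS ∕ mass-gap ∕ Clay.  No `sorry`, no `def`, no `instance`, no `notation`.  Unit `pub-ymgap-dag-n05-c` (g17), 2026-08-28.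
-/

noncomputable section

open NormedSpace

namespace Literature.MathematicalPhysics.QuantumFieldTheory.Balaban1983to89.B8Thm8SurvivingZdGF3HP2PerMapLanEGammaGuarded

open Complex (I)
open MatrixLog B7Prop1Explicit B7Prop2Explicit B7Prop1Local B7Eq92Concrete
open B7Prop2Explicit (C0 c2')
open B7Prop3Flat (c3)
open B8Ineq132 (covDerivFwd InAk BondTouches)
open B8Eq119TwistedAxial (Restr129 InAx)
open B8Eq184Proof (gaugeExp cfgExp)
open B8Lemma1NonAbelian (mulCfg)
open B8Eq140Level (SideTouches)
open B8Eq146AExpansion (iEta)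
open B7Prop4GeneralLevels (logCovIter linCovIter)
open B8Eq155JBound (Jcur wsup)
open B8ScaledSupNorm (bondNorm msup)
open B8Thm2LogB (blockTop)
open B8Ineq130 (tlo thi)
open B8Eq138LandauZd (IsLandau146W InR138 logCfg)
open B8Thm4Windows (thm4_windows thm4_windows_extra)
open B8Thm4ExistsConcreteGamma (thm4_windows_γ)
open B8LeafModelZd (ZdIdx)
open B8LeafModelZd3 (zdGF3)
open B8LeafModelZd3P (zdGF3P zdGF3HP)
open B8LeafModelZd3P2 (zdGF3P₂ zdGF3HP₂)
open B8TowerBondsPrinted (towerBondsP)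
open B8ScaledSupNorm (Bdd)
open B8Ineq166Univ (norm_pert_sub_one_le_univ)
open B8Thm4CoreZdGF3HP2PerLanEGamma (thm4Core_zdGF3HP₂Per_map_lanE_γ')
open B8LeafModelZdHP2Per (zdGF3HP₂Per)
open T4TermwiseTorus (IsPeriodic)

-- `Site` alone could resolve to the torus sites of `Setup.lean`; re-export the `ℤ^d` sites of `B7Prop1Explicit`.
export B7Prop1Explicit (Site)

variable {d : ℕ}

/-! ## Theorem 8 surviving on the periodic sub-model `zdGF3HP₂Per ∘ (ι, p)`, guarded sockets, E currency, edition γ′ -/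

section Thm8

variable {𝔸 : Type} [CStarAlgebra 𝔸] [Nontrivial 𝔸]

/-- ★★★ **THEOREM 8 IN ITS SURVIVING FORM ON THE PERIODIC SUB-MODEL `zdGF3HP₂Per ∘ (ι, p)` OF THE EDITION-δ₂ P-CARRIER, OVER AN INDEX MAP AND A PERIOD MAP,
MODULO PERIODICITY-GUARDED SOCKETS AT `ι a` (EDITION γ′) — NO «EXACTLY ONE ⇒ PERIODIC» DEVICE.**  dag-n05-d's ℤᵈ server `thm8SurvivingAt_zdGF3HP₂_map_lanE_γ'`
re-run at the periodic member: for any `ι : J → ZdIdx d L`, `p : J → ℕ` onto `Ω₀ = ℤᵈ` members obeying the tower law at every truncation and with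
`(p a)`-periodic domains `Ω_j` (`j ≤ k`), `B8Thm8Surviving.Thm8SurvivingAt γ (5dL·B₈·(1+11d²)) (5dL·B₀β·(1+11d²)) (zdGF3HP₂Per … ∘ (ι, p))` MODULO the five
sourced sockets demanded `∀ a : J` AT `ι a` AND AT PERIODIC ARGUMENTS ONLY — `SP5base` ∕ `SP5` ∕ `SH59src` ∕ `SP5u` in the γ′ letters with dag-n05-w1's
periodicity GUARDS (pair guard `IsPeriodic (p a) U₀ → IsPeriodic (p a) U′`; the source `φ` periodic inside its admissibility; periodic level data ∕ outputs ∕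
competitors) and the sourced Proposition 3 `SP3src` AT THE PERIODIC MEMBER (`U₀, P′, f` in the periodic carriers) with the γ edition's (1.61)
«`2α₂² + 20dα₀α₂ + 2C₂α₂² ≤ α₀ + α₁`, `C₂ = 2097152(d+1)²L²`».  Proof = the ℤᵈ server's verbatim with: core := T5 `thm4Core_zdGF3HP₂Per_map_lanE_γ'` at the
periodic source admissibility (the member's `f : Src` is periodic: `f.2`); `InAAx`'s first conjunct pins `P.1 = U₀` as periodic carriers (`Subtype.ext`); the γ
windows at the shifted pair `(α₀, α″ := 11d²(α₀+α₁) + α₁)`; (1.37) at the ORIGINAL `α₁` by `B8Eq142KLevelLocalGammaPrime.H42_of_inAx_γ'`; (1.65) ⇒ (1.66)₀ by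
`B8Ineq166Univ` (`Ω₀ = ℤᵈ`).  The witness `u` is the core's element of the PERIODIC gauge group; uniqueness among periodic competitors is the core's.  Constants unchanged.
[cite: Balaban1985RegularSpaces, Thm 8 (1.146) p.101, Thm 2 p.83, Thm 4 p.88, Prop. 3 p.87, (1.61) p.87, (1.65)–(1.66) pp.87–88, (1.42) p.83, (1.31) p.82, (1.35) p.82, p.77 («Ω_j ⊂ T_η»); Balaban1985BackgroundPropagators, Thm 3.3 p.398] -/
theorem thm8SurvivingAt_zdGF3HP₂Per_map_lanE_γ'_guarded (hd2 : 2 ≤ d) {L : ℕ} (hL : 2 ≤ L) {β : ℝ} {len : Site d → ℝ}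
    {B₀ B₀' B₀β cu cP cP3 γ γ' B₈ : ℝ} (hB₀ : 0 < B₀) (hB₀' : 0 < B₀') (hcu : 0 < cu) (hcP : 0 < cP) (hcP3 : 0 < cP3)
    (hγ : 0 < γ) (hγ' : 0 ≤ γ') (hB₈ : 0 < B₈) (hB₀8 : B₀ ≤ B₈) (hB : 2 ≤ 5 * (d : ℝ) * L * B₈)
    (hγB : 5 * (d : ℝ) * L * B₀ + 2 * (γ' * B₀) ≤ 5 * (d : ℝ) * L * B₈)
    {J : Type} (ι : J → ZdIdx d L) (p : J → ℕ) (hΩ0 : ∀ a : J, (ι a).Ω 0 = Set.univ)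
    -- the domains `Ω_j`, `j ≤ k`, of every member are `(p a)`-periodic (the periodic (1.5)-index's law; print's «Ω_j ⊂ T_η», p. 77)
    (hΩp : ∀ a : J, ∀ j, j ≤ (ι a).k → IsPeriodic (p a) (fun x : Site d => x ∈ (ι a).Ω j))
    -- the tower law at EVERY truncation of every member ((1.5)–(1.6) p. 77; `IdxB8Sub.tower_all` at the law members)
    (htw : ∀ a : J, ∀ m, m ≤ (ι a).k → ∀ j, j ≤ m → ∀ y ∈ (ι a).Λs m j, ∀ x, InBox (tlo L y j) (thi L y j) x → x ∈ (ι a).Ω j)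
    (LanF : J → (Site d → Fin d → 𝔸ˣ) → (Site d → 𝔸) → ℕ → (Site d → Fin d → 𝔸ˣ) → Prop)
    (hLanF : ∀ (a : J) (U₀ : Site d → Fin d → 𝔸ˣ) (f : Site d → 𝔸) (W : Site d → Fin d → 𝔸ˣ),
      LanF a U₀ f (ι a).k W ↔ IsLandau146W L (ι a).k (ι a).η ((ι a).Ω 0) ((ι a).Λs (ι a).k) U₀ f W)
    (SP5base : ∀ a : J, ∀ α₀ α₁ : ℝ, 0 < α₀ → 0 < α₁ → α₀ + α₁ ≤ cP →
      ∀ U₀ U' : Site d → Fin d → 𝔸ˣ, (∀ x κ, U₀ x κ ∈ unitaryUnits 𝔸) → (∀ x κ, U' x κ ∈ unitaryUnits 𝔸) →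
      IsPeriodic (p a) U₀ → IsPeriodic (p a) U' → ∀ φ : Site d → 𝔸, (((InR138 L (ι a).k (ι a).η ((ι a).Ω 0) ((ι a).Λs (ι a).k) U₀ φ ∧ (∀ x, IsSelfAdjoint (φ x)) ∧ (∀ x, x ∉ (ι a).Ω 0 → φ x = 0) ∧
          Bdd L (ι a).k (ι a).η (-(2 : ℝ)) (fun j (x : Site d) => x ∈ (ι a).Ω j) φ) ∧ IsPeriodic (p a) φ) ∧
        msup L (ι a).k (ι a).η (-(2 : ℝ)) (fun j (x : Site d) => x ∈ (ι a).Ω j) φ < γ * (α₀ + α₁)) →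
      InAk L (ι a).k (ι a).η α₀ (ι a).Ω U₀ → InAk L (ι a).k (ι a).η α₀ (ι a).Ω (mulCfg U' U₀) → (∀ m, m ≤ (ι a).k → InAx L m ((ι a).Λs m) U₀ (mulCfg U' U₀)) →
      (∀ j, j ≤ (ι a).k → ∀ (z : Site d) (μ : Fin d),
        ((∀ x, InBox (tlo L z j) (thi L z j) x → x ∈ (ι a).Ω j) ∨ (∀ x, InBox (tlo L (z + e μ) j) (thi L (z + e μ) j) x → x ∈ (ι a).Ω j)) →
        ‖(avgIter L (mulCfg U' U₀) j z μ : 𝔸) - (avgIter L U₀ j z μ : 𝔸)‖ ≤ α₁) →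
      (∀ b ∈ {b : Site d × Fin d | SideTouches ((ι a).Ω 0) b.1 b.2}, ‖((U' b.1 b.2 : 𝔸ˣ) : 𝔸) - 1‖ ≤ α₁) →
      (∃ (v : Site d → 𝔸ˣ) (lam : Site d → 𝔸), (∀ x, v x ∈ unitaryUnits 𝔸) ∧ (∀ x, x ∉ (ι a).Ω 0 → v x = 1) ∧
        (∀ j, j ≤ 1 → ∀ b ∈ {b : Site d × Fin d | SideTouches ((ι a).Ω j) b.1 b.2}, (v b.1 : 𝔸) = ((gaugeExp lam b.1 : 𝔸ˣ) : 𝔸) ∧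
        (v (b.1 + e b.2) : 𝔸) = ((gaugeExp lam (b.1 + e b.2) : 𝔸ˣ) : 𝔸)) ∧
        (∀ j, j ≤ 1 → ∀ b ∈ {b : Site d × Fin d | SideTouches ((ι a).Ω j) b.1 b.2},
        ‖lam b.1‖ ≤ (8 * B₀' * (5 * (d : ℝ) * L * B₈) * (α₀ + α₁)) ∧ ((L : ℝ) ^ j * (ι a).η) * ‖covDerivFwd (ι a).η U₀ b.2 lam b.1‖ ≤ (8 * B₀' * (5 * (d : ℝ) * L * B₈) * (α₀ + α₁))) ∧
        LanF a U₀ φ 1 (mgauge U₀ v⁻¹ U') ∧ Restr129 L 1 ((ι a).Λs 1) U₀ ((1 : Site d → 𝔸ˣ) * v) ∧ IsPeriodic (p a) v))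
    (SP5 : ∀ a : J, ∀ α₀ α₁ : ℝ, 0 < α₀ → 0 < α₁ → α₀ + α₁ ≤ cP →
      ∀ U₀ U' : Site d → Fin d → 𝔸ˣ, (∀ x κ, U₀ x κ ∈ unitaryUnits 𝔸) → (∀ x κ, U' x κ ∈ unitaryUnits 𝔸) →
      IsPeriodic (p a) U₀ → IsPeriodic (p a) U' → ∀ φ : Site d → 𝔸, (((InR138 L (ι a).k (ι a).η ((ι a).Ω 0) ((ι a).Λs (ι a).k) U₀ φ ∧ (∀ x, IsSelfAdjoint (φ x)) ∧ (∀ x, x ∉ (ι a).Ω 0 → φ x = 0) ∧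
          Bdd L (ι a).k (ι a).η (-(2 : ℝ)) (fun j (x : Site d) => x ∈ (ι a).Ω j) φ) ∧ IsPeriodic (p a) φ) ∧
        msup L (ι a).k (ι a).η (-(2 : ℝ)) (fun j (x : Site d) => x ∈ (ι a).Ω j) φ < γ * (α₀ + α₁)) →
      InAk L (ι a).k (ι a).η α₀ (ι a).Ω U₀ → InAk L (ι a).k (ι a).η α₀ (ι a).Ω (mulCfg U' U₀) → (∀ m, m ≤ (ι a).k → InAx L m ((ι a).Λs m) U₀ (mulCfg U' U₀)) →
      (∀ j, j ≤ (ι a).k → ∀ (z : Site d) (μ : Fin d),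
        ((∀ x, InBox (tlo L z j) (thi L z j) x → x ∈ (ι a).Ω j) ∨ (∀ x, InBox (tlo L (z + e μ) j) (thi L (z + e μ) j) x → x ∈ (ι a).Ω j)) →
        ‖(avgIter L (mulCfg U' U₀) j z μ : 𝔸) - (avgIter L U₀ j z μ : 𝔸)‖ ≤ α₁) →
      (∀ b ∈ {b : Site d × Fin d | SideTouches ((ι a).Ω 0) b.1 b.2}, ‖((U' b.1 b.2 : 𝔸ˣ) : 𝔸) - 1‖ ≤ α₁) →
      (∀ m, 1 ≤ m → m < (ι a).k → ∀ (u₁ : Site d → 𝔸ˣ) (U₁ : Site d → Fin d → 𝔸ˣ) (A : Site d → Fin d → 𝔸),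
        (∀ x, u₁ x ∈ unitaryUnits 𝔸) → (∀ x, x ∉ (ι a).Ω 0 → u₁ x = 1) → IsPeriodic (p a) u₁ → IsPeriodic (p a) U₁ → IsPeriodic (p a) A →
        mgauge U₀ u₁ U₁ = U' → Restr129 L m ((ι a).Λs m) U₀ u₁ →
        LanF a U₀ φ m U₁ →
        (∀ j, j ≤ m → ∀ b ∈ {b : Site d × Fin d | SideTouches ((ι a).Ω j) b.1 b.2},
        U₁ b.1 b.2 = cfgExp (ι a).η A b.1 b.2 ∧ IsSelfAdjoint (A b.1 b.2) ∧ ‖A b.1 b.2‖ ≤ (5 * (d : ℝ) * L * B₈ * (α₀ + α₁)) * ((L : ℝ) ^ j * (ι a).η)⁻¹) →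
        ∃ (v : Site d → 𝔸ˣ) (lam : Site d → 𝔸), (∀ x, v x ∈ unitaryUnits 𝔸) ∧ (∀ x, x ∉ (ι a).Ω 0 → v x = 1) ∧
        (∀ j, j ≤ m + 1 → ∀ b ∈ {b : Site d × Fin d | SideTouches ((ι a).Ω j) b.1 b.2}, (v b.1 : 𝔸) = ((gaugeExp lam b.1 : 𝔸ˣ) : 𝔸) ∧
        (v (b.1 + e b.2) : 𝔸) = ((gaugeExp lam (b.1 + e b.2) : 𝔸ˣ) : 𝔸)) ∧
        (∀ j, j ≤ m + 1 → ∀ b ∈ {b : Site d × Fin d | SideTouches ((ι a).Ω j) b.1 b.2},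
        ‖lam b.1‖ ≤ (8 * B₀' * (5 * (d : ℝ) * L * B₈) * (α₀ + α₁)) ∧ ((L : ℝ) ^ j * (ι a).η) * ‖covDerivFwd (ι a).η U₀ b.2 lam b.1‖ ≤ (8 * B₀' * (5 * (d : ℝ) * L * B₈) * (α₀ + α₁))) ∧
        LanF a U₀ φ (m + 1) (mgauge U₀ v⁻¹ U₁) ∧ Restr129 L (m + 1) ((ι a).Λs (m + 1)) U₀ (u₁ * v) ∧ IsPeriodic (p a) v))
    (SH59src : ∀ a : J, ∀ α₀ α₁ : ℝ, 0 < α₀ → 0 < α₁ → α₀ + α₁ ≤ cP →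
      ∀ U₀ U' : Site d → Fin d → 𝔸ˣ, (∀ x κ, U₀ x κ ∈ unitaryUnits 𝔸) → (∀ x κ, U' x κ ∈ unitaryUnits 𝔸) →
      IsPeriodic (p a) U₀ → IsPeriodic (p a) U' → ∀ φ : Site d → 𝔸, (((InR138 L (ι a).k (ι a).η ((ι a).Ω 0) ((ι a).Λs (ι a).k) U₀ φ ∧ (∀ x, IsSelfAdjoint (φ x)) ∧ (∀ x, x ∉ (ι a).Ω 0 → φ x = 0) ∧
          Bdd L (ι a).k (ι a).η (-(2 : ℝ)) (fun j (x : Site d) => x ∈ (ι a).Ω j) φ) ∧ IsPeriodic (p a) φ) ∧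
        msup L (ι a).k (ι a).η (-(2 : ℝ)) (fun j (x : Site d) => x ∈ (ι a).Ω j) φ < γ * (α₀ + α₁)) →
      InAk L (ι a).k (ι a).η α₀ (ι a).Ω U₀ → InAk L (ι a).k (ι a).η α₀ (ι a).Ω (mulCfg U' U₀) → (∀ m, m ≤ (ι a).k → InAx L m ((ι a).Λs m) U₀ (mulCfg U' U₀)) →
      (∀ j, j ≤ (ι a).k → ∀ (z : Site d) (μ : Fin d),
        ((∀ x, InBox (tlo L z j) (thi L z j) x → x ∈ (ι a).Ω j) ∨ (∀ x, InBox (tlo L (z + e μ) j) (thi L (z + e μ) j) x → x ∈ (ι a).Ω j)) →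
        ‖(avgIter L (mulCfg U' U₀) j z μ : 𝔸) - (avgIter L U₀ j z μ : 𝔸)‖ ≤ α₁) →
      (∀ b ∈ {b : Site d × Fin d | SideTouches ((ι a).Ω 0) b.1 b.2}, ‖((U' b.1 b.2 : 𝔸ˣ) : 𝔸) - 1‖ ≤ α₁) →
      (∀ m, 1 ≤ m → m ≤ (ι a).k → ∀ (u : Site d → 𝔸ˣ) (W : Site d → Fin d → 𝔸ˣ) (A' : Site d → Fin d → 𝔸),
        (∀ x, u x ∈ unitaryUnits 𝔸) → IsPeriodic (p a) u → IsPeriodic (p a) W → IsPeriodic (p a) A' →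
        mgauge U₀ u W = U' → Restr129 L m ((ι a).Λs m) U₀ u → LanF a U₀ φ m W →
        (∀ y τ, IsSelfAdjoint (A' y τ)) →
        (∀ j, j ≤ m → ∀ y τ, SideTouches ((ι a).Ω j) y τ →
        W y τ = cfgExp (ι a).η A' y τ ∧ ‖A' y τ‖ ≤ (2 * (L * (5 * (d : ℝ) * L * B₈ * (α₀ + α₁))) + 8 * (8 * B₀' * (5 * (d : ℝ) * L * B₈) * (α₀ + α₁))) * ((L : ℝ) ^ j * (ι a).η)⁻¹) →
        (∀ y τ, (∀ j, j ≤ m → ¬ SideTouches ((ι a).Ω j) y τ) → A' y τ = 0) →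
        msup L m (ι a).η (-(1 : ℝ)) (fun j (b : Site d × Fin d) => SideTouches ((ι a).Ω j) b.1 b.2) (fun b => A' b.1 b.2)
        ≤ B₀ * (bondNorm L m (ι a).η (-(3 : ℝ)) (ι a).Ω (fun x μ => Jcur (ι a).η U₀ A' μ x)
        + wsup 1 (fun p : {p : ℕ × (Site d × Fin d) // p.1 ≤ m ∧ p.2 ∈ towerBondsP L (ι a).Ω ((ι a).Λs m) p.1} =>
        linCovIter L U₀ (iEta (ι a).η A') p.1.1 p.1.2.1 p.1.2.2)) + γ' * B₀ * (α₀ + α₁) ∧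
        msup L m (ι a).η (-(2 : ℝ)) (fun j (t : Fin d × Fin d × Site d) => SideTouches ((ι a).Ω j) t.2.2 t.2.1)
        (fun t => covDerivFwd (ι a).η U₀ t.1 (fun z => A' z t.2.1) t.2.2)
        ≤ B₀ * (bondNorm L m (ι a).η (-(3 : ℝ)) (ι a).Ω (fun x μ => Jcur (ι a).η U₀ A' μ x)
        + wsup 1 (fun p : {p : ℕ × (Site d × Fin d) // p.1 ≤ m ∧ p.2 ∈ towerBondsP L (ι a).Ω ((ι a).Λs m) p.1} =>
        linCovIter L U₀ (iEta (ι a).η A') p.1.1 p.1.2.1 p.1.2.2)) + γ' * B₀ * (α₀ + α₁)))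
    (SP5u : ∀ a : J, ∀ α₀ α₁ : ℝ, 0 < α₀ → 0 < α₁ → α₀ + α₁ ≤ cP →
      ∀ U₀ U' : Site d → Fin d → 𝔸ˣ, (∀ x κ, U₀ x κ ∈ unitaryUnits 𝔸) → (∀ x κ, U' x κ ∈ unitaryUnits 𝔸) →
      IsPeriodic (p a) U₀ → IsPeriodic (p a) U' → ∀ φ : Site d → 𝔸, (((InR138 L (ι a).k (ι a).η ((ι a).Ω 0) ((ι a).Λs (ι a).k) U₀ φ ∧ (∀ x, IsSelfAdjoint (φ x)) ∧ (∀ x, x ∉ (ι a).Ω 0 → φ x = 0) ∧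
          Bdd L (ι a).k (ι a).η (-(2 : ℝ)) (fun j (x : Site d) => x ∈ (ι a).Ω j) φ) ∧ IsPeriodic (p a) φ) ∧
        msup L (ι a).k (ι a).η (-(2 : ℝ)) (fun j (x : Site d) => x ∈ (ι a).Ω j) φ < γ * (α₀ + α₁)) →
      InAk L (ι a).k (ι a).η α₀ (ι a).Ω U₀ → InAk L (ι a).k (ι a).η α₀ (ι a).Ω (mulCfg U' U₀) → (∀ m, m ≤ (ι a).k → InAx L m ((ι a).Λs m) U₀ (mulCfg U' U₀)) →
      (∀ j, j ≤ (ι a).k → ∀ (z : Site d) (μ : Fin d),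
        ((∀ x, InBox (tlo L z j) (thi L z j) x → x ∈ (ι a).Ω j) ∨ (∀ x, InBox (tlo L (z + e μ) j) (thi L (z + e μ) j) x → x ∈ (ι a).Ω j)) →
        ‖(avgIter L (mulCfg U' U₀) j z μ : 𝔸) - (avgIter L U₀ j z μ : 𝔸)‖ ≤ α₁) →
      (∀ b ∈ {b : Site d × Fin d | SideTouches ((ι a).Ω 0) b.1 b.2}, ‖((U' b.1 b.2 : 𝔸ˣ) : 𝔸) - 1‖ ≤ α₁) →
      ∀ u₁ : Site d → 𝔸ˣ, (∀ x, u₁ x ∈ unitaryUnits 𝔸) → (∀ x, x ∉ (ι a).Ω 0 → u₁ x = 1) → IsPeriodic (p a) u₁ → Restr129 L (ι a).k ((ι a).Λs (ι a).k) U₀ u₁ →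
      LanF a U₀ φ (ι a).k (mgauge U₀ u₁⁻¹ U') →
      (∃ A₁ : Site d → Fin d → 𝔸, ∀ j, j ≤ (ι a).k → ∀ (x : Site d) (κ : Fin d), SideTouches ((ι a).Ω j) x κ →
        mgauge U₀ u₁⁻¹ U' x κ = cfgExp (ι a).η A₁ x κ ∧ ‖A₁ x κ‖ ≤ (5 * (d : ℝ) * L * B₈ * (α₀ + α₁)) * ((L : ℝ) ^ j * (ι a).η)⁻¹) →
      ∀ (v w : Site d → 𝔸ˣ) (lam mu : Site d → 𝔸),
      IsPeriodic (p a) v → IsPeriodic (p a) w → IsPeriodic (p a) lam → IsPeriodic (p a) mu →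
      (∀ x, ((gaugeExp lam x : 𝔸ˣ) : 𝔸) = ((v x : 𝔸ˣ) : 𝔸) ∧ IsSelfAdjoint (lam x) ∧ ‖lam x‖ < cu) → (∀ x, x ∉ (ι a).Ω 0 → lam x = 0) →
      (∀ j, j ≤ (ι a).k → ∀ b ∈ {b : Site d × Fin d | SideTouches ((ι a).Ω j) b.1 b.2}, ((L : ℝ) ^ j * (ι a).η) * ‖covDerivFwd (ι a).η U₀ b.2 lam b.1‖ < cu) →
      (∀ x, ((gaugeExp mu x : 𝔸ˣ) : 𝔸) = ((w x : 𝔸ˣ) : 𝔸) ∧ IsSelfAdjoint (mu x) ∧ ‖mu x‖ < cu) → (∀ x, x ∉ (ι a).Ω 0 → mu x = 0) →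
      (∀ j, j ≤ (ι a).k → ∀ b ∈ {b : Site d × Fin d | SideTouches ((ι a).Ω j) b.1 b.2}, ((L : ℝ) ^ j * (ι a).η) * ‖covDerivFwd (ι a).η U₀ b.2 mu b.1‖ < cu) →
      LanF a U₀ φ (ι a).k (mgauge U₀ v⁻¹ (mgauge U₀ u₁⁻¹ U')) → Restr129 L (ι a).k ((ι a).Λs (ι a).k) U₀ (u₁ * v) →
      LanF a U₀ φ (ι a).k (mgauge U₀ w⁻¹ (mgauge U₀ u₁⁻¹ U')) → Restr129 L (ι a).k ((ι a).Λs (ι a).k) U₀ (u₁ * w) →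
      ∀ x, v x = w x)
    (SP3src : ∀ a : J, ∀ α₀ α₁ α₂ : ℝ, 0 < α₀ → α₀ ≤ cP3 → 0 < α₁ → α₁ ≤ cP3 → 0 < α₂ → α₂ ≤ cP3 →
      2 * α₂ ^ 2 + 20 * d * α₀ * α₂ + 2 * (2097152 * ((d : ℝ) + 1) ^ 2 * (L : ℝ) ^ 2) * α₂ ^ 2 ≤ α₀ + α₁ →
      ∀ (U₀ : (zdGF3HP₂Per 𝔸 L β len (ι a) (p a)).Cfg) (P' : (zdGF3HP₂Per 𝔸 L β len (ι a) (p a)).Pert) (f : (zdGF3HP₂Per 𝔸 L β len (ι a) (p a)).Src),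
        (zdGF3HP₂Per 𝔸 L β len (ι a) (p a)).InR U₀ f → (zdGF3HP₂Per 𝔸 L β len (ι a) (p a)).fNorm f < γ * (α₀ + α₁) → (zdGF3HP₂Per 𝔸 L β len (ι a) (p a)).fGrad U₀ f < γ * (α₀ + α₁) →
        (zdGF3HP₂Per 𝔸 L β len (ι a) (p a)).InA α₀ U₀ → (zdGF3HP₂Per 𝔸 L β len (ι a) (p a)).InAPair α₀ U₀ P' → (zdGF3HP₂Per 𝔸 L β len (ι a) (p a)).C162 1 α₂ U₀ P' →
        (zdGF3HP₂Per 𝔸 L β len (ι a) (p a)).LandauF U₀ f P' → (zdGF3HP₂Per 𝔸 L β len (ι a) (p a)).C137 α₁ U₀ P' →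
        (zdGF3HP₂Per 𝔸 L β len (ι a) (p a)).C136 (5 * d * L * B₈) (5 * d * L * B₀β) (α₀ + α₁) U₀ P' ∧
          (zdGF3HP₂Per 𝔸 L β len (ι a) (p a)).C139 (5 * d * L * B₈) (α₀ + α₁) U₀ P') :
    B8Thm8Surviving.Thm8SurvivingAt γ (5 * (d : ℝ) * L * B₈ * (1 + 11 * (d : ℝ) ^ 2)) (5 * (d : ℝ) * L * B₀β * (1 + 11 * (d : ℝ) ^ 2))
      (fun a : J => zdGF3HP₂Per 𝔸 L β len (ι a) (p a)) := by
  have hL1 : 1 ≤ L := le_trans (by norm_num) hL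
  have hd1 : 1 ≤ d := le_trans (by norm_num) hd2
  have hL' : (1 : ℝ) ≤ L := by exact_mod_cast hL1
  have hd' : (1 : ℝ) ≤ d := by exact_mod_cast hd1
  -- the Theorem-4-shaped core at the source-indexed gauge predicate, the windows
  obtain ⟨c4, hc4, H4⟩ := thm4Core_zdGF3HP₂Per_map_lanE_γ' (𝔸 := 𝔸) (β := β) (len := len) hd2 hL hB₀ hB₀' hcu hcP (Φ := Site d → 𝔸) hγ' hB₈ hB₀8 hB
    hγB ι p (fun a f U₀ a0 b0 => ((InR138 L (ι a).k (ι a).η ((ι a).Ω 0) ((ι a).Λs (ι a).k) U₀ f ∧ (∀ x, IsSelfAdjoint (f x)) ∧ (∀ x, x ∉ (ι a).Ω 0 → f x = 0) ∧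
        Bdd L (ι a).k (ι a).η (-(2 : ℝ)) (fun j (x : Site d) => x ∈ (ι a).Ω j) f) ∧ IsPeriodic (p a) f) ∧
      msup L (ι a).k (ι a).η (-(2 : ℝ)) (fun j (x : Site d) => x ∈ (ι a).Ω j) f < γ * (a0 + b0)) LanF SP5base SP5 SH59src SP5u
  obtain ⟨cw, hcw, hw⟩ := thm4_windows hd1 hL1 hB₈ hB₀' hB
  obtain ⟨cw', hcw', hw'⟩ := thm4_windows_extra (d := d) hL1
  obtain ⟨cγ, hcγ, hwγ⟩ := thm4_windows_γ hd1 hL1 hB₈ hB₀' hB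
  -- constants
  set D : ℝ := 1 + 11 * (d : ℝ) ^ 2 with hD_def
  have hD1 : 1 ≤ D := le_add_of_nonneg_right (by positivity)
  have hD0 : 0 < D := lt_of_lt_of_le one_pos hD1
  have hDne : D ≠ 0 := hD0.ne'
  have hK₁ : 0 < 5 * (d : ℝ) * L * B₈ := by positivity
  have hK₁D : 0 < 5 * (d : ℝ) * L * B₈ * D := mul_pos hK₁ hD0
  -- the threshold
  set cT : ℝ := min (min (min (c4 / D) (cγ / D)) (min (cw / D) (cw' / D)))
    (min (min (cP3 / D) (cP3 / (5 * (d : ℝ) * L * B₈ * D))) (1 / (6 * D))) with hcT_def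
  have hcT : 0 < cT :=
    lt_min (lt_min (lt_min (div_pos hc4 hD0) (div_pos hcγ hD0)) (lt_min (div_pos hcw hD0) (div_pos hcw' hD0)))
      (lt_min (lt_min (div_pos hcP3 hD0) (div_pos hcP3 hK₁D)) (by positivity))
  refine ⟨cT, hcT, ?_⟩
  intro a α₀ α₁ hα₀ hα₁ hs U₀ P f hInA hReg hInAAx havg hInR hf
  have hS0 : 0 < α₀ + α₁ := add_pos hα₀ hα₁
  -- unpack the thresholds
  have hle : ∀ {c : ℝ}, cT ≤ c / D → D * (α₀ + α₁) ≤ c := by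
    intro c hc
    have h1 : α₀ + α₁ ≤ c / D := hs.trans hc
    calc D * (α₀ + α₁) ≤ D * (c / D) := mul_le_mul_of_nonneg_left h1 hD0.le
      _ = c := by field_simp
  have hs4 : D * (α₀ + α₁) ≤ c4 := hle ((min_le_left _ _).trans ((min_le_left _ _).trans (min_le_left _ _)))
  have hsγ : D * (α₀ + α₁) ≤ cγ := hle ((min_le_left _ _).trans ((min_le_left _ _).trans (min_le_right _ _)))
  have hsw : D * (α₀ + α₁) ≤ cw := hle ((min_le_left _ _).trans ((min_le_right _ _).trans (min_le_left _ _)))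
  have hsw' : D * (α₀ + α₁) ≤ cw' := hle ((min_le_left _ _).trans ((min_le_right _ _).trans (min_le_right _ _)))
  have hs3 : D * (α₀ + α₁) ≤ cP3 := hle ((min_le_right _ _).trans ((min_le_left _ _).trans (min_le_left _ _)))
  have hs3' : 5 * (d : ℝ) * L * B₈ * D * (α₀ + α₁) ≤ cP3 := by
    have h1 : α₀ + α₁ ≤ cP3 / (5 * (d : ℝ) * L * B₈ * D) :=
      hs.trans ((min_le_right _ _).trans ((min_le_left _ _).trans (min_le_right _ _)))
    calc 5 * (d : ℝ) * L * B₈ * D * (α₀ + α₁) ≤ 5 * (d : ℝ) * L * B₈ * D * (cP3 / (5 * (d : ℝ) * L * B₈ * D)) :=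
        mul_le_mul_of_nonneg_left h1 hK₁D.le
      _ = cP3 := by field_simp
  have hs6 : D * (α₀ + α₁) ≤ 1 / 6 := by
    have h1 : α₀ + α₁ ≤ 1 / (6 * D) := hs.trans ((min_le_right _ _).trans (min_le_right _ _))
    calc D * (α₀ + α₁) ≤ D * (1 / (6 * D)) := mul_le_mul_of_nonneg_left h1 hD0.le
      _ = 1 / 6 := by field_simp
  -- the shifted pair `(α₀, α″)`
  set α'' : ℝ := 11 * (d : ℝ) ^ 2 * (α₀ + α₁) + α₁ with hα''_def
  have h11 : 0 ≤ 11 * (d : ℝ) ^ 2 * (α₀ + α₁) := by positivity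
  have h11' : 0 ≤ 11 * (d : ℝ) ^ 2 * α₁ := by positivity
  have hα'' : 0 < α'' := by rw [hα''_def]; linarith only [h11, hα₁]
  have hsum : α₀ + α'' = D * (α₀ + α₁) := by simp only [hα''_def, hD_def]; ring
  have hα₁'' : α₁ ≤ α'' := by rw [hα''_def]; linarith only [h11]
  have h165 : 11 * (d : ℝ) ^ 2 * α₀ + α₁ ≤ α'' := by rw [hα''_def]; linarith only [h11']
  have hSS : α₀ + α₁ ≤ α₀ + α'' := by linarith only [hα₁'']
  -- windows at the shifted pair
  obtain ⟨-, -, -, -, w5, w6, w7, -, -, -, -, -, -, -, -, -, -, -⟩ :=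
    hw α₀ α'' hα₀ hα'' (hsum ▸ hsw) (5 * (d : ℝ) * L * B₈ * (α₀ + α'')) (8 * B₀' * (5 * (d : ℝ) * L * B₈) * (α₀ + α'')) rfl rfl
  obtain ⟨w19, -⟩ := hw' α₀ α'' hα₀ hα'' (hsum ▸ hsw')
  -- the γ windows at the shifted pair ([3] Prop. 4 at `(L²α₀, L·α₂)`; (1.61) with `C₂ = 2097152(d+1)²L²`)
  obtain ⟨g3, g4, g16, gsmall, gc₃, -, g61⟩ :=
    hwγ α₀ α'' hα₀ hα'' (hsum ▸ hsγ) (5 * (d : ℝ) * L * B₈ * (α₀ + α'')) (8 * B₀' * (5 * (d : ℝ) * L * B₈) * (α₀ + α'')) rfl rfl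
  have hsmall₁ : (d : ℝ) * L * α₁ ≤ 1 / 8 := (mul_le_mul_of_nonneg_left hα₁'' (by positivity)).trans w19
  have hα2 : 2 * α₀ ≤ c2' d L := by linarith only [w6, hα₀]
  -- the data
  obtain ⟨hP1, h34, hAx⟩ := hInAAx
  -- `InAAx`'s first conjunct pins the pair's background to `U₀` (as periodic carriers)
  have hQU : P.1 = U₀ := Subtype.ext (congrArg Subtype.val hP1 :)
  subst hQU
  -- (1.66)₀ on all bonds (Ω₀ = ℤᵈ): (1.65)
  have hpart' : ∀ x : Site d, ∃ j, j ≤ (ι a).k ∧ ∃ y ∈ (ι a).Λs (ι a).k j, InBox (tlo L y j) (thi L y j) x := by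
    intro x
    have hx : x ∈ (ι a).Ω 0 := by rw [hΩ0 a]; trivial
    exact (ι a).hpart x hx
  have hsm : 11 * (d : ℝ) ^ 2 * α₀ + α₁ ≤ 1 / 6 := by linarith only [h165, hα₀, hsum, hs6]
  -- the P-carrier's (1.35) letter (one-end-point class) CONTAINS the box form `B8Ineq166Univ` reads (`endBlockIn_of_box`)
  have havgB : ∀ j, j ≤ (ι a).k → ∀ (z : Site d) (μ : Fin d), (∀ x, InBox (loK L j z) (bondHiK L j z μ) x → x ∈ (ι a).Ω j) →
      ‖(avgIter L (mulCfg P.2.1 P.1.1) j z μ : 𝔸) - (avgIter L P.1.1 j z μ : 𝔸)‖ ≤ α₁ :=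
    fun j hj z μ hbox => havg j hj z μ (B8LeafModelZd3P.endBlockIn_of_box L ((ι a).Ω j) j z μ hbox)
  have h66 : ∀ b ∈ {b : Site d × Fin d | SideTouches ((ι a).Ω 0) b.1 b.2}, ‖((P.2.1 b.1 b.2 : 𝔸ˣ) : 𝔸) - 1‖ ≤ α'' := by
    intro b _
    have h := norm_pert_sub_one_le_univ hd1 hL (ι a).k (η := (ι a).η) P.1.2.1 P.2.2.1 hα₀ w5 hα2 hα₁.le hsm
      (ι a).Ω (ι a).hΩ ((ι a).Λs (ι a).k) (ι a).htower hpart' hInA h34 (hAx (ι a).k le_rfl) havgB b.1 b.2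
    exact h.trans h165
  have h166 : (zdGF3HP₂Per 𝔸 L β len (ι a) (p a)).avgClose166 α'' P.1 P :=
    ⟨fun j hj z μ hb => (havg j hj z μ hb).trans hα₁'', h66⟩
  -- the source is admitted at the shifted pair
  have hfS : msup L (ι a).k (ι a).η (-(2 : ℝ)) (fun j (x : Site d) => x ∈ (ι a).Ω j) f.1 < γ * (α₀ + α'') :=
    lt_of_lt_of_le hf (mul_le_mul_of_nonneg_left hSS hγ.le)
  -- THE THEOREM-4-SHAPED CORE at the shifted pair
  obtain ⟨u, hR, ⟨h137'', hLan, h162⟩, huniq⟩ :=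
    H4 a (htw a) (hΩp a) α₀ α'' hα₀ hα'' (hsum ▸ hs4) P.1 P f.1 ⟨⟨hInR, f.2⟩, hfS⟩ hInA ⟨rfl, h34, hAx⟩ h166
  have hLF : (zdGF3HP₂Per 𝔸 L β len (ι a) (p a)).LandauF P.1 f ((zdGF3HP₂Per 𝔸 L β len (ι a) (p a)).act P u) := (hLanF a P.1.1 f.1 _).1 hLan
  have hcs0 : 0 ≤ 5 * (d : ℝ) * L * B₈ * (α₀ + α'') := by positivity
  -- PROPOSITION 3 WITH SOURCE at (α₀, α″, α₂ := c⋆″) for the gauge-fixed field (socket), under the inspected size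
  have hSD : α₀ + α₁ ≤ D * (α₀ + α₁) := le_mul_of_one_le_left hS0.le hD1
  have hα₀3 : α₀ ≤ cP3 := by linarith only [hα₁, hSD, hs3]
  have hα''3 : α'' ≤ cP3 := by linarith only [hα₀, hsum, hs3]
  have hcs3 : 5 * (d : ℝ) * L * B₈ * (α₀ + α'') ≤ cP3 := by
    rw [hsum, ← mul_assoc]; exact hs3'
  have hcspos : 0 < 5 * (d : ℝ) * L * B₈ * (α₀ + α'') := by positivity
  have hKS0 : 0 ≤ 2 * (L * (5 * (d : ℝ) * L * B₈ * (α₀ + α''))) + 8 * (8 * B₀' * (5 * (d : ℝ) * L * B₈) * (α₀ + α'')) := by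
    positivity
  have hcK : 5 * (d : ℝ) * L * B₈ * (α₀ + α'') ≤
      2 * (L * (5 * (d : ℝ) * L * B₈ * (α₀ + α''))) + 8 * (8 * B₀' * (5 * (d : ℝ) * L * B₈) * (α₀ + α'')) := by
    have h₁ : (1 : ℝ) * (5 * (d : ℝ) * L * B₈ * (α₀ + α'')) ≤ L * (5 * (d : ℝ) * L * B₈ * (α₀ + α'')) :=
      mul_le_mul_of_nonneg_right hL' hcs0
    have h₂ : 0 ≤ 8 * (8 * B₀' * (5 * (d : ℝ) * L * B₈) * (α₀ + α'')) := by positivity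
    linarith only [h₁, h₂, hcs0]
  have h61 : 2 * (5 * (d : ℝ) * L * B₈ * (α₀ + α'')) ^ 2 + 20 * d * α₀ * (5 * (d : ℝ) * L * B₈ * (α₀ + α'')) +
      2 * (2097152 * ((d : ℝ) + 1) ^ 2 * (L : ℝ) ^ 2) * (5 * (d : ℝ) * L * B₈ * (α₀ + α'')) ^ 2 ≤ α₀ + α'' := by
    set c := 5 * (d : ℝ) * L * B₈ * (α₀ + α'') with hc
    set K := 2 * (L * c) + 8 * (8 * B₀' * (5 * (d : ℝ) * L * B₈) * (α₀ + α'')) with hK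
    have hcKle : c ≤ K := hcK
    have hc0 : 0 ≤ c := hcs0
    have hC : (2 : ℝ) * (16 * (131072 * ((d : ℝ) + 1) ^ 2) * (L : ℝ) ^ 2) = 2 * (2097152 * ((d : ℝ) + 1) ^ 2 * (L : ℝ) ^ 2) := by ring
    rw [← hC]
    have hmono : 2 * c ^ 2 + 20 * d * α₀ * c + 2 * (16 * (131072 * ((d : ℝ) + 1) ^ 2) * (L : ℝ) ^ 2) * c ^ 2 ≤
        2 * K ^ 2 + 20 * d * α₀ * K + 2 * (16 * (131072 * ((d : ℝ) + 1) ^ 2) * (L : ℝ) ^ 2) * K ^ 2 := by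
      have h1 : c ^ 2 ≤ K ^ 2 := pow_le_pow_left₀ hc0 hcKle 2
      have h2 : 0 ≤ 20 * (d : ℝ) * α₀ := by positivity
      have h3 : 0 ≤ 2 * (16 * (131072 * ((d : ℝ) + 1) ^ 2) * (L : ℝ) ^ 2) := by positivity
      have h4 := mul_le_mul_of_nonneg_left hcKle h2
      have h5 := mul_le_mul_of_nonneg_left h1 h3
      linarith only [h1, h4, h5]
    exact hmono.trans g61
  have hu : ∀ x, u.1 x ∈ unitaryUnits 𝔸 := u.2.1.1
  have hW : mgauge P.1.1 u.1 (mgauge P.1.1 u.1⁻¹ P.2.1) = P.2.1 := B8Thm4AtLandau138.mgauge_mgauge_inv P.1.1 P.2.1 u.1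
  -- (1.37) at the ORIGINAL `α₁`: the (1.42) lemma on the canonical exponent of the gauge-fixed field (as in `thm2Printed_zd3_univ`)
  have hc16 : 16 * (5 * (d : ℝ) * L * B₈ * (α₀ + α'')) ≤ 1 := by linarith only [w7, hcK, hKS0]
  have hWu : ∀ x κ, mgauge P.1.1 u.1⁻¹ P.2.1 x κ ∈ unitaryUnits 𝔸 :=
    B8Prop3GaugeFixedKLevel.mem_unitaryUnits_of_mgauge_eq P.1.2.1 P.2.2.1 hu hW
  have hWA : ∀ j, j ≤ (ι a).k → ∀ y τ, SideTouches ((ι a).Ω j) y τ →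
      mgauge P.1.1 u.1⁻¹ P.2.1 y τ = cfgExp (ι a).η (logCfg (ι a).η (mgauge P.1.1 u.1⁻¹ P.2.1)) y τ ∧
        ‖logCfg (ι a).η (mgauge P.1.1 u.1⁻¹ P.2.1) y τ‖ ≤ (5 * (d : ℝ) * L * B₈ * (α₀ + α'')) * ((L : ℝ) ^ j * (ι a).η)⁻¹ :=
    fun j hj y τ h => ⟨(h162 j hj (y, τ) h).1, (h162 j hj (y, τ) h).2.2⟩
  obtain ⟨hA'sa, hA'eq, hA'zero⟩ := B8LeafModelZd3.mlogCfg_spec (ι a).hη hL1 (ι a).k P.1.1 hWu hcs0 hc16 (ι a).Ω hWA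
  set A' := B8LeafModelZd3.mlogCfg (ι a).k (ι a).η (ι a).Ω (mgauge P.1.1 u.1⁻¹ P.2.1) with hA'_def
  have hA'bd : ∀ j, j ≤ (ι a).k → ∀ y τ, SideTouches ((ι a).Ω j) y τ →
      mgauge P.1.1 u.1⁻¹ P.2.1 y τ = cfgExp (ι a).η A' y τ ∧
        ‖A' y τ‖ ≤ (2 * (L * (5 * (d : ℝ) * L * B₈ * (α₀ + α''))) + 8 * (8 * B₀' * (5 * (d : ℝ) * L * B₈) * (α₀ + α''))) *
          ((L : ℝ) ^ j * (ι a).η)⁻¹ := by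
    intro j hj y τ h
    obtain ⟨hAA, hWexp⟩ := hA'eq j hj y τ h
    refine ⟨hWexp, ?_⟩
    rw [hAA]
    have hη0 : 0 ≤ (ι a).η := (ι a).hη.le
    exact ((hWA j hj y τ h).2).trans (mul_le_mul_of_nonneg_right hcK (by positivity))
  have h137 : (zdGF3HP₂Per 𝔸 L β len (ι a) (p a)).C137 α₁ P.1 ((zdGF3HP₂Per 𝔸 L β len (ι a) (p a)).act P u) :=
    B8Eq142KLevelLocalGammaPrime.H42_of_inAx_γ' hd2 (ι a).hη hL (ι a).k P.1.2.1 hα₀ hα₁ hKS0 g3 g4 g16 gsmall gc₃ hsmall₁ (ι a).Ω (ι a).hΩ (ι a).Λs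
      (fun m j => towerBondsP L (ι a).Ω ((ι a).Λs m) j) (B8TowerBondsPrinted.ZdIdx.towerBondsP_laws (ι a)).1
      (B8TowerBondsPrinted.ZdIdx.towerBondsP_laws (ι a)).2 hInA h34 hAx havg (fun m W => LanF a P.1.1 f.1 m W) (ι a).k (ι a).hk le_rfl
      (htw a (ι a).k le_rfl) u.1 (mgauge P.1.1 u.1⁻¹ P.2.1) A' hu hW hR hLan hA'sa hA'bd hA'zero
  have hPair : (zdGF3HP₂Per 𝔸 L β len (ι a) (p a)).InAPair α₀ P.1 ((zdGF3HP₂Per 𝔸 L β len (ι a) (p a)).act P u) := by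
    show InAk L (ι a).k (ι a).η α₀ (ι a).Ω (mulCfg (mgauge P.1.1 u.1⁻¹ P.2.1) P.1.1)
    have hui : ∀ x, u.1⁻¹ x ∈ U1 𝔸 := fun x => unitaryUnits_le_U1 ((unitaryUnits 𝔸).inv_mem (hu x))
    rw [B8Prop3GaugeFixedKLevel.mulCfg_eq_gaugeAct_of_mgauge_eq hW]
    exact (B8Ineq132.inAk_gaugeAct_iff L (ι a).k (ι a).η α₀ (ι a).Ω hui _).2 h34
  have h162' : (zdGF3HP₂Per 𝔸 L β len (ι a) (p a)).C162 1 (5 * (d : ℝ) * L * B₈ * (α₀ + α'')) P.1 ((zdGF3HP₂Per 𝔸 L β len (ι a) (p a)).act P u) := by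
    intro j hj b hb
    obtain ⟨h1, h2, h3⟩ := h162 j hj b hb
    exact ⟨h1, h2, by rw [one_mul]; exact h3⟩
  -- constants: `5dLB₈(α₀ + α″) = B₁(α₀ + α₁)`, `5dL·B₀β·(α₀ + α″) = B₂(α₀ + α₁)`
  have e1 : 5 * (d : ℝ) * (L : ℝ) * B₈ * (α₀ + α'') = 5 * (d : ℝ) * L * B₈ * (1 + 11 * (d : ℝ) ^ 2) * (α₀ + α₁) := by
    rw [hsum, hD_def]; ring
  have e2 : 5 * (d : ℝ) * (L : ℝ) * B₀β * (α₀ + α'') = 5 * (d : ℝ) * L * B₀β * (1 + 11 * (d : ℝ) ^ 2) * (α₀ + α₁) := by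
    rw [hsum, hD_def]; ring
  refine ⟨u, hR, ⟨fun j hj b hb => ?_, ?_, hLF, fun hgrad => ?_⟩, ?_⟩
  · -- (1.62)-shape at `B₁(α₀ + α₁)`
    obtain ⟨h1, h2, h3⟩ := h162 j hj b hb
    exact ⟨h1, h2, by rw [← e1]; exact h3⟩
  · exact h137
  · -- the conditional (1.36) ∧ (1.39) from the SOURCED Proposition 3 at (α₀, α″, c⋆″)
    have hgrad'' : (zdGF3HP₂Per 𝔸 L β len (ι a) (p a)).fGrad P.1 f < γ * (α₀ + α'') := lt_of_lt_of_le hgrad (mul_le_mul_of_nonneg_left hSS hγ.le)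
    obtain ⟨h136, h139⟩ := SP3src a α₀ α'' (5 * (d : ℝ) * L * B₈ * (α₀ + α'')) hα₀ hα₀3 hα'' hα''3 hcspos hcs3 h61 P.1
      ((zdGF3HP₂Per 𝔸 L β len (ι a) (p a)).act P u) f hInR hfS hgrad'' hInA hPair h162' hLF h137''
    obtain ⟨h136a, h136g, h136h⟩ := h136
    obtain ⟨h139j, h139l⟩ := h139
    refine ⟨⟨fun j hj b hb => ?_, by rw [← e1]; exact h136g, by rw [← e2]; exact h136h⟩,
      ⟨by rw [← e1]; exact h139j, by rw [← e1]; exact h139l⟩⟩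
    obtain ⟨h1, h2, h3⟩ := h136a j hj b hb
    exact ⟨h1, h2, by rw [← e1]; exact h3⟩
  -- uniqueness: the core's, since (1.36) at `B₁(α₀ + α₁) = 5dLB₈(α₀ + α″)` is the (1.62)-shape there
  · intro u' hR' h136' _ _ hLanF'
    refine huniq u' hR' ((hLanF a P.1.1 f.1 _).2 hLanF') ?_
    intro j hj b hb
    obtain ⟨h1, h2, h3⟩ := h136'.1 j hj b hb
    refine ⟨h1, h2, ?_⟩
    rw [e1]
    exact h3

end Thm8

#print axioms thm8SurvivingAt_zdGF3HP₂Per_map_lanE_γ'_guarded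

end Literature.MathematicalPhysics.QuantumFieldTheory.Balaban1983to89.B8Thm8SurvivingZdGF3HP2PerMapLanEGammaGuarded

end
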